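import Mathlib
import HarnessLib
import Literature.MathematicalPhysics.KineticTheory.VelocityFlipNoise
import Literature.MathematicalPhysics.KineticTheory.LangevinChainDynkin
import Summits.AtomisticToContinuum.FouriersLaw.Theorems.VanishingNoiseTransferVanishingNoiseBoundFlipMildForwardFieldTemps
import Summits.AtomisticToContinuum.FouriersLaw.Theorems.VanishingNoiseTransferVanishingNoiseBoundFlipWeakToClassical
import Summits.AtomisticToContinuum.FouriersLaw.Theorems.VanishingNoiseTransferVanishingNoiseBoundFlipWeakContinuity
import Summits.AtomisticToContinuum.FouriersLaw.Theorems.VanishingNoiseTransferVanishingNoiseBoundFlipUniformMoments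
import Summits.AtomisticToContinuum.FouriersLaw.Theorems.VanishingNoiseTransferVanishingNoiseBoundFlipResponseFrame
import Summits.AtomisticToContinuum.FouriersLaw.Theorems.VanishingNoiseTransferVanishingNoiseBoundFlipDualTranspose

/-!
# Stub `stub_flipPositiveConductance` of line `sector-dirichlet-gluing`, part 3: the dual forward field hypothesis
`FF''(ε)` assembled from the three open fixed-`N` stubs of the sister crux `VanishingNoiseBound`
(crux `VanishingNoiseTransfer.NoisyFourier`, item stmt-AtomisticToContinuum-11977)

Helper file `--supports stmt-AtomisticToContinuum-11977` (route `VanishingNoiseTransfer`, line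
`sector-dirichlet-gluing`, stub `stub_flipPositiveConductance`).

ROAD B of the stub (parts 1–2: `…FlipPositiveConductanceAux1/2`) ends in the derivative-free dual forward field
hypothesis `FF''(ε)` of the dual Kubo link of crux `VanishingNoiseBound` (stmt-AtomisticToContinuum-11976,
`VanishingNoiseBound.noisyPositiveConductance_of_dualForwardFields`). The registered skeleton (r5) of that crux
splits `FF''(ε)` into four fixed-`N` stubs, all about the centred MILD forward fields
`g = R_{Lε}((Lε)⁻¹(k_0 − c) + Q g)` (`k_0 = p_0² − T`, `R_r` the resolvent kernel of the flip-free dynamics, `Q` the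
flip average):
* MILD (`stub_flipMildDistributional`): an `e^{H/4T}`-bounded measurable mild field is a distributional solution of
  `(L_{T_L,T_R} + εS) g = −(k_0 − c)` (tested through the Lebesgue transpose);
* HYPO (`stub_flipHypoelliptic`): exponentially bounded distributional solutions with smooth source are a.e. smooth;
* UPGRADE (`stub_flipSmoothMildUpgrade`, PROVED: `…VanishingNoiseBoundFlipSmoothMildUpgrade`): the continuous
  representative of a mild field is again mild and `e^{H/4T}`-bounded everywhere;
* CONT (`stub_flipMildContinuity`): the Gibbs pairings `⟨g_δ, k_b⟩_{μ_T}` (`b = 0, L−1`) of a mild family `g_δ` at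
  bath temperatures `T ± δ/2` with centring constants `c_δ → c₀` converge, as `δ → 0`, `δ ≠ 0`, to those of a continuous
  equilibrium mild field `g₀` with constant `c₀`.

This file proves, sorry-free, the ASSEMBLY
`dualForwardFields_of_mild_hypo_upgrade_cont : MILD → HYPO → UPGRADE → CONT → FF''(ε)`
(the four statements taken VERBATIM as hypotheses), from the landed bricks of crux `VanishingNoiseBound`:
existence of centred mild fields at unequal temperatures (`flip_mildForwardField_exists_temps`), smooth distributional
solutions are classical (`flip_classical_of_weak_smooth`), uniform exponential moments and weak continuity of the
unique flip-steady family (`flip_uniform_exp_moment`, `flip_tendsto_integral_of_growth`), `μ_{T,T} = μ_T`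
(`family_eq_gibbsMeasure`) and equipartition (`pinnedChain_integral_snd_sq`). Construction: `g δ` := a centred mild
field at `(T + δ/2, T − δ/2)` for `0 < |δ| < T` (centring constant `c_δ = μ_δ(k_0)`), `g 0` := the smooth
representative (HYPO) of the equilibrium mild field (`c_0 = μ_T(k_0) = 0`), which is mild (UPGRADE), distributional
(MILD) and hence classical; clause (iv) of `FF''(ε)` is MILD at `(T ± δ/2)`, clauses (v)–(vi) are CONT with
`c_δ → 0` (`centring_tendsto_zero`).

* `integral_kin_sub_family_self` — `μ_{L,T,T}(p_0² − T) = 0`;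
* `helper_flipCentringConstantTendsto` — registered helper: `μ_{L,T+δ/2,T−δ/2}(p_0² − T) → 0` (`δ → 0`, `δ ≠ 0`);
* `dualForwardFields_of_mild_hypo_upgrade_cont` — the assembly.

With parts 1–2 this reduces stub `stub_flipPositiveConductance` to MILD ∧ HYPO ∧ CONT (UPGRADE being proved).
No definitions; axioms `propext`, `Classical.choice`, `Quot.sound` only.
-/

noncomputable section

open MeasureTheory Filter Topology
open scoped ContDiff

namespace Summit.AtomisticToContinuum.FouriersLaw.Theorems.NoisyFourier.FlipPositiveConductance

open Literature.MathematicalPhysics.KineticTheory.HeatConduction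
open Summit.AtomisticToContinuum.FouriersLaw.Theorems.SuperadditiveResistance.DeviceLiouville (kin kin_eq_sq)
open Summit.AtomisticToContinuum.FouriersLaw.Theorems.SubdiffusiveBondHeat (abs_sq_momentum_sub_le_exp)
open Summit.AtomisticToContinuum.FouriersLaw.Theorems.VanishingNoiseBound (flip_mildForwardField_exists_temps
  flip_classical_of_weak_smooth flip_tendsto_integral_of_growth flip_uniform_exp_moment family_eq_gibbsMeasure
  two_div_lt_inv_max)
open Summit.AtomisticToContinuum.FouriersLaw.Cruxes.SuperadditiveResistance.FloatingProbeBypassLaplacian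
  (pinnedChain_memLp_two_snd pinnedChain_integral_snd_sq)

section Centring

variable {ω₂ lam β γ : ℝ}

/-- **No excess kinetic temperature at zero bias**: along a flip-steady family unique in its class,
`∫ (p_0² − T) dμ_{L,T,T} = 0` (`μ_{L,T,T} = μ_T`, `family_eq_gibbsMeasure`, and equipartition
`⟨p_0²⟩_{μ_T} = T`, `pinnedChain_integral_snd_sq`). -/
theorem integral_kin_sub_family_self (hω : 0 < ω₂) (hl : 0 ≤ lam) (hβ : 0 ≤ β) (ε : ℝ)
    {μ : (N : ℕ) → ℝ → ℝ → Measure (PhaseSpace N)}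
    (hμ : ∀ (N : ℕ) (T_L T_R : ℝ), 0 < T_L → 0 < T_R →
      (pinnedChain ω₂ lam β γ).IsFlipSteadyState N T_L T_R ε (μ N T_L T_R) ∧
        ∀ ν : Measure (PhaseSpace N), (pinnedChain ω₂ lam β γ).IsFlipSteadyState N T_L T_R ε ν → ν = μ N T_L T_R)
    {T : ℝ} (hT : 0 < T) {L : ℕ} (hL : 0 < L) :
    ∫ y, (kin L 0 y - T) ∂(μ L T T) = 0 := by
  rw [family_eq_gibbsMeasure hω hl hβ γ ε hμ L hT]
  haveI := pinnedChain_isProbabilityMeasure_gibbsMeasure hω hl hβ γ L hT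
  have i2 : Integrable (fun x : PhaseSpace L => x.2 ⟨0, hL⟩ ^ 2) ((pinnedChain ω₂ lam β γ).gibbsMeasure L T) :=
    (pinnedChain_memLp_two_snd hω hl hβ γ L hT ⟨0, hL⟩).integrable_sq
  simp only [kin_eq_sq hL]
  rw [integral_sub i2 (integrable_const T), pinnedChain_integral_snd_sq hω hl hβ γ L hT ⟨0, hL⟩, integral_const,
    probReal_univ, one_smul, sub_self]

/-- **The centring constants tend to zero**: along a flip-steady family unique in its class (all parameters `> 0`,
`ε > 0`, `T > 0`, `L ≥ 2`), `∫ (p_0² − T) dμ_{L,T+δ/2,T−δ/2} → 0` as `δ → 0`, `δ ≠ 0` — weak continuity of the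
family on exponentially dominated observables (`flip_tendsto_integral_of_growth`, uniform exponential moments
`flip_uniform_exp_moment`, `|p_0² − T| ≤ C e^{H/4T}`) and `integral_kin_sub_family_self`. -/
theorem centring_tendsto_zero (hω : 0 < ω₂) (hl : 0 < lam) (hβ : 0 < β) (hγ : 0 < γ) {ε : ℝ} (hε : 0 < ε)
    {μ : (N : ℕ) → ℝ → ℝ → Measure (PhaseSpace N)}
    (hμ : ∀ (N : ℕ) (T_L T_R : ℝ), 0 < T_L → 0 < T_R →
      (pinnedChain ω₂ lam β γ).IsFlipSteadyState N T_L T_R ε (μ N T_L T_R) ∧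
        ∀ ν : Measure (PhaseSpace N), (pinnedChain ω₂ lam β γ).IsFlipSteadyState N T_L T_R ε ν → ν = μ N T_L T_R)
    {T : ℝ} (hT : 0 < T) {L : ℕ} (hL : 2 ≤ L) :
    Tendsto (fun δ : ℝ => ∫ y, (kin L 0 y - T) ∂(μ L (T + δ / 2) (T - δ / 2))) (𝓝[≠] 0) (𝓝 0) := by
  have hL0 : 0 < L := by omega
  obtain ⟨M, hM⟩ := flip_uniform_exp_moment hω hl hβ hγ hε μ hμ hT hL
  have hkc : Continuous fun y : PhaseSpace L => kin L 0 y - T := by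
    simp only [kin_eq_sq hL0]
    fun_prop
  have h140 : (0 : ℝ) < 1 / (4 * T) := by positivity
  have h1412 : 1 / (4 * T) < 1 / (2 * T) := by
    rw [one_div_lt_one_div (by positivity) (by positivity)]; linarith
  have hkb : ∀ x : PhaseSpace L, |kin L 0 x - T| ≤
      (2 / (1 / (4 * T)) + T) * Real.exp (1 / (4 * T) * (pinnedChain ω₂ lam β γ).hamiltonian L x) := fun x => by
    rw [kin_eq_sq hL0]
    exact abs_sq_momentum_sub_le_exp (γ := γ) hω hl.le hβ.le h140 hT.le x ⟨0, hL0⟩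
  have h := (flip_tendsto_integral_of_growth hω hl hβ ε μ hμ hT hM hkc h140.le h1412 hkb).2
  rwa [integral_kin_sub_family_self hω hl.le hβ.le ε hμ hT hL0] at h

end Centring

/-! ## Registered helper -/

/-- Registered helper sub-goal `helper_flipCentringConstantTendsto` of stub `stub_flipPositiveConductance` (line
`sector-dirichlet-gluing`, crux stmt-AtomisticToContinuum-11977): the centring constants `μ_{L,T+δ/2,T−δ/2}(p_0² − T)`
of the mild forward fields tend to `0` as `δ → 0`, `δ ≠ 0` (`centring_tendsto_zero`). -/
theorem helper_flipCentringConstantTendsto : ∀ (ω₂ lam β γ ε : ℝ), 0 < ω₂ → 0 < lam → 0 < β → 0 < γ → 0 < ε → ∀ (μ : (N : ℕ) → ℝ → ℝ → MeasureTheory.Measure (Literature.MathematicalPhysics.KineticTheory.HeatConduction.PhaseSpace N)), (∀ (N : ℕ) (T_L T_R : ℝ), 0 < T_L → 0 < T_R → (Literature.MathematicalPhysics.KineticTheory.HeatConduction.pinnedChain ω₂ lam β γ).IsFlipSteadyState N T_L T_R ε (μ N T_L T_R) ∧ ∀ ν : MeasureTheory.Measure (Literature.MathematicalPhysics.KineticTheory.HeatConduction.PhaseSpace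 N), (Literature.MathematicalPhysics.KineticTheory.HeatConduction.pinnedChain ω₂ lam β γ).IsFlipSteadyState N T_L T_R ε ν → ν = μ N T_L T_R) → ∀ (T : ℝ), 0 < T → ∀ (L : ℕ), 2 ≤ L → Filter.Tendsto (fun δ : ℝ => ∫ y, (Summit.AtomisticToContinuum.FouriersLaw.Theorems.SuperadditiveResistance.DeviceLiouville.kin L 0 y - T) ∂(μ L (T + δ / 2) (T - δ / 2))) (nhdsWithin 0 {(0 : ℝ)}ᶜ) (nhds 0) :=
  fun _ _ _ _ _ hω hl hβ hγ hε _ hμ _ hT _ hL => centring_tendsto_zero hω hl hβ hγ hε hμ hT hL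

/-! ## The assembly `MILD → HYPO → UPGRADE → CONT → FF''(ε)` -/

/-- **The dual forward field hypothesis `FF''(ε)` from MILD, HYPO, UPGRADE, CONT** (the four registered fixed-`N`
stubs of the skeleton r5 of crux `VanishingNoiseBound`, stmt-AtomisticToContinuum-11976, taken verbatim as
hypotheses; UPGRADE is proved in `…VanishingNoiseBoundFlipSmoothMildUpgrade`). See the module docstring for the
construction of the family `g`. The conclusion is VERBATIM the hypothesis of
`VanishingNoiseBound.noisyPositiveConductance_of_dualForwardFields` (= of the registered stub
`stub_dualKuboRoadLanded` of that crux, and of `flipPositiveConductance_of_dualForwardFields` of part 2). -/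
theorem dualForwardFields_of_mild_hypo_upgrade_cont
    (hMILD : ∀ (ω₂ lam β γ : ℝ) (hω : 0 < ω₂) (hl : 0 < lam) (hβ : 0 < β) (hγ : 0 < γ) (L : ℕ) (hL : 2 ≤ L) (T T_L T_R : ℝ) (hT : 0 < T) (hTL : 0 < T_L) (hTR : 0 < T_R), 1 / (4 * T) < 1 / max T_L T_R → ∀ (ε : ℝ), 0 < ε → ∀ (c : ℝ) (g : PhaseSpace L → ℝ), Measurable g → (∃ C : ℝ, ∀ z, |g z| ≤ C * Real.exp (1 / (4 * T) * (pinnedChain ω₂ lam β γ).hamiltonian L z)) → (∀ z, g z = ∫ y, (((L : ℝ) * ε)⁻¹ * ((y.2 ⟨0, by omega⟩ ^ 2 - T) - c) + (L : ℝ)⁻¹ * ∑ i : Fin L, g (momentumFlip i y)) ∂((pinnedChainSemigroup hω hl.le hβ.le hγ.le (by omega) hTL.le hTR.le).resolventKernel ((L : ℝ) * ε) z)) → ∀ φ : PhaseSpace L → ℝ, ContDiff ℝ ((⊤ : ℕ∞) : WithTop ℕ∞) φ → HasCompactSupport φ → ∫ x, g x * (-((pinnedChain ω₂ lam β γ).generator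 L T_L T_R φ x) + 2 * γ * (T_L * partialP (⟨0, by omega⟩ : Fin L) (partialP (⟨0, by omega⟩ : Fin L) φ) x + T_R * partialP (⟨L - 1, by omega⟩ : Fin L) (partialP (⟨L - 1, by omega⟩ : Fin L) φ) x) + 2 * γ * φ x + ε * flipNoise L φ x) = ∫ x, (-(Theorems.SuperadditiveResistance.DeviceLiouville.kin L 0 x - T) + c) * φ x)
    (hHYPO : ∀ (ω₂ lam β γ : ℝ), 0 < ω₂ → 0 < lam → 0 < β → 0 < γ → ∀ (L : ℕ) (hL : 2 ≤ L) (T_L T_R ε : ℝ), 0 < T_L → 0 < T_R → 0 ≤ ε → ∀ (u F : PhaseSpace L → ℝ), Measurable u → (∃ C θ : ℝ, ∀ x, |u x| ≤ C * Real.exp (θ * (pinnedChain ω₂ lam β γ).hamiltonian L x)) → ContDiff ℝ ((⊤ : ℕ∞) : WithTop ℕ∞) F → (∀ φ : PhaseSpace L → ℝ, ContDiff ℝ ((⊤ : ℕ∞) : WithTop ℕ∞) φ → HasCompactSupport φ → ∫ x, u x * (-((pinnedChain ω₂ lam β γ).generator L T_L T_R φ x) + 2 * γ * (T_L * partialP (⟨0,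 by omega⟩ : Fin L) (partialP (⟨0, by omega⟩ : Fin L) φ) x + T_R * partialP (⟨L - 1, by omega⟩ : Fin L) (partialP (⟨L - 1, by omega⟩ : Fin L) φ) x) + 2 * γ * φ x + ε * flipNoise L φ x) = ∫ x, F x * φ x) → ∃ v : PhaseSpace L → ℝ, ContDiff ℝ ((⊤ : ℕ∞) : WithTop ℕ∞) v ∧ ∀ᵐ x ∂(volume : Measure (PhaseSpace L)), u x = v x)
    (hUP : ∀ (ω₂ lam β γ : ℝ) (hω : 0 < ω₂) (hl : 0 < lam) (hβ : 0 < β) (hγ : 0 < γ) (L : ℕ) (hL : 2 ≤ L) (T : ℝ) (hT : 0 < T) (ε : ℝ), 0 < ε → ∀ (c : ℝ) (g g' : PhaseSpace L → ℝ), Measurable g → (∃ C : ℝ, ∀ z, |g z| ≤ C * Real.exp (1 / (4 * T) * (pinnedChain ω₂ lam β γ).hamiltonian L z)) → (∀ z, g z = ∫ y, (((L : ℝ) * ε)⁻¹ * ((y.2 ⟨0, by omega⟩ ^ 2 - T) - c) + (L : ℝ)⁻¹ * ∑ i : Fin L, g (momentumFlip i y)) ∂((pinnedChainSemigroup hω hl.le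 hβ.le hγ.le (by omega) hT.le hT.le).resolventKernel ((L : ℝ) * ε) z)) → Continuous g' → (∀ᵐ x ∂(volume : Measure (PhaseSpace L)), g x = g' x) → (∃ C : ℝ, ∀ z, |g' z| ≤ C * Real.exp (1 / (4 * T) * (pinnedChain ω₂ lam β γ).hamiltonian L z)) ∧ ∀ z, g' z = ∫ y, (((L : ℝ) * ε)⁻¹ * ((y.2 ⟨0, by omega⟩ ^ 2 - T) - c) + (L : ℝ)⁻¹ * ∑ i : Fin L, g' (momentumFlip i y)) ∂((pinnedChainSemigroup hω hl.le hβ.le hγ.le (by omega) hT.le hT.le).resolventKernel ((L : ℝ) * ε) z))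
    (hCONT : ∀ (ω₂ lam β γ : ℝ) (hω : 0 < ω₂) (hl : 0 < lam) (hβ : 0 < β) (hγ : 0 < γ) (L : ℕ) (hL : 2 ≤ L) (T : ℝ) (hT : 0 < T) (ε : ℝ), 0 < ε → ∀ (g : ℝ → PhaseSpace L → ℝ) (c : ℝ → ℝ) (g₀ : PhaseSpace L → ℝ) (c₀ δ₁ : ℝ), 0 < δ₁ → δ₁ ≤ T → Tendsto c (𝓝[≠] 0) (𝓝 c₀) → Continuous g₀ → (∃ C : ℝ, ∀ z, |g₀ z| ≤ C * Real.exp (1 / (4 * T) * (pinnedChain ω₂ lam β γ).hamiltonian L z)) → (∀ z, g₀ z = ∫ y, (((L : ℝ) * ε)⁻¹ * ((y.2 ⟨0, by omega⟩ ^ 2 - T) - c₀) + (L : ℝ)⁻¹ * ∑ i : Fin L, g₀ (momentumFlip i y)) ∂((pinnedChainSemigroup hω hl.le hβ.le hγ.le (by omega) hT.le hT.le).resolventKernel ((L : ℝ) * ε) z)) → (∀ (δ : ℝ) (hTL : 0 < T + δ / 2) (hTR : 0 < T - δ / 2), 0 < |δ| → |δ| < δ₁ → Measurable (g δ) ∧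 (∃ C : ℝ, ∀ z, |g δ z| ≤ C * Real.exp (1 / (4 * T) * (pinnedChain ω₂ lam β γ).hamiltonian L z)) ∧ ∀ z, g δ z = ∫ y, (((L : ℝ) * ε)⁻¹ * ((y.2 ⟨0, by omega⟩ ^ 2 - T) - c δ) + (L : ℝ)⁻¹ * ∑ i : Fin L, g δ (momentumFlip i y)) ∂((pinnedChainSemigroup hω hl.le hβ.le hγ.le (by omega) hTL.le hTR.le).resolventKernel ((L : ℝ) * ε) z)) → Tendsto (fun δ => ∫ x, g δ x * (Theorems.SuperadditiveResistance.DeviceLiouville.kin L 0 x - T) ∂((pinnedChain ω₂ lam β γ).gibbsMeasure L T)) (𝓝[≠] 0) (𝓝 (∫ x, g₀ x * (Theorems.SuperadditiveResistance.DeviceLiouville.kin L 0 x - T) ∂((pinnedChain ω₂ lam β γ).gibbsMeasure L T))) ∧ Tendsto (fun δ => ∫ x, g δ x * (Theorems.SuperadditiveResistance.DeviceLiouville.kin L (L - 1) x - T) ∂((pinnedChain ω₂ lam β γ).gibbsMeasure L T)) (𝓝[≠] 0) (𝓝 (∫ x, g₀ x * (Theorems.SuperadditiveResistance.DeviceLiouville.kin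 L (L - 1) x - T) ∂((pinnedChain ω₂ lam β γ).gibbsMeasure L T)))) :
    ∀ (ω₂ lam β γ T ε : ℝ), 0 < ω₂ → 0 < lam → 0 < β → 0 < γ → 0 < T → 0 < ε → ∀ μ : (N : ℕ) → ℝ → ℝ → MeasureTheory.Measure (Literature.MathematicalPhysics.KineticTheory.HeatConduction.PhaseSpace N), (∀ (N : ℕ) (T_L T_R : ℝ), 0 < T_L → 0 < T_R → (Literature.MathematicalPhysics.KineticTheory.HeatConduction.pinnedChain ω₂ lam β γ).IsFlipSteadyState N T_L T_R ε (μ N T_L T_R) ∧ ∀ ν : MeasureTheory.Measure (Literature.MathematicalPhysics.KineticTheory.HeatConduction.PhaseSpace N), (Literature.MathematicalPhysics.KineticTheory.HeatConduction.pinnedChain ω₂ lam β γ).IsFlipSteadyState N T_L T_R ε ν → ν = μ N T_L T_R) → ∀ (L : ℕ) (hL : 2 ≤ L), ∃ (g : ℝ → Literature.MathematicalPhysics.KineticTheory.HeatConduction.PhaseSpace L → ℝ) (δ₀ : ℝ), 0 < δ₀ ∧ ContDiff ℝ 2 (g 0) ∧ (∀ x, (Literature.MathematicalPhysics.KineticTheory.HeatConduction.pinnedChain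 ω₂ lam β γ).flipGenerator L T T ε (g 0) x = -(Summit.AtomisticToContinuum.FouriersLaw.Theorems.SuperadditiveResistance.DeviceLiouville.kin L 0 x - T)) ∧ (∀ δ, |δ| < δ₀ → ∃ C : ℝ, ∀ x, |g δ x| ≤ C * Real.exp (1 / (4 * T) * (Literature.MathematicalPhysics.KineticTheory.HeatConduction.pinnedChain ω₂ lam β γ).hamiltonian L x)) ∧ (∀ δ, 0 < |δ| → |δ| < δ₀ → Measurable (g δ) ∧ ∀ φ : Literature.MathematicalPhysics.KineticTheory.HeatConduction.PhaseSpace L → ℝ, ContDiff ℝ ((⊤ : ℕ∞) : WithTop ℕ∞) φ → HasCompactSupport φ → ∫ x, g δ x * (-((Literature.MathematicalPhysics.KineticTheory.HeatConduction.pinnedChain ω₂ lam β γ).generator L (T + δ / 2) (T - δ / 2) φ x) + 2 * γ * ((T + δ / 2) * Literature.MathematicalPhysics.KineticTheory.HeatConduction.partialP (⟨0, by omega⟩ : Fin L) (Literature.MathematicalPhysics.KineticTheory.HeatConduction.partialP (⟨0, by omega⟩ : Fin L) φ) x + (T - δ / 2) * Literature.MathematicalPhysics.KineticTheory.HeatConduction.partialP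 (⟨L - 1, by omega⟩ : Fin L) (Literature.MathematicalPhysics.KineticTheory.HeatConduction.partialP (⟨L - 1, by omega⟩ : Fin L) φ) x) + 2 * γ * φ x + ε * Literature.MathematicalPhysics.KineticTheory.HeatConduction.flipNoise L φ x) = ∫ x, (-(Summit.AtomisticToContinuum.FouriersLaw.Theorems.SuperadditiveResistance.DeviceLiouville.kin L 0 x - T) + ∫ y, (Summit.AtomisticToContinuum.FouriersLaw.Theorems.SuperadditiveResistance.DeviceLiouville.kin L 0 y - T) ∂(μ L (T + δ / 2) (T - δ / 2))) * φ x) ∧ Filter.Tendsto (fun δ => ∫ x, g δ x * (Summit.AtomisticToContinuum.FouriersLaw.Theorems.SuperadditiveResistance.DeviceLiouville.kin L 0 x - T) ∂((Literature.MathematicalPhysics.KineticTheory.HeatConduction.pinnedChain ω₂ lam β γ).gibbsMeasure L T)) (nhdsWithin 0 {(0 : ℝ)}ᶜ) (nhds (∫ x, g 0 x * (Summit.AtomisticToContinuum.FouriersLaw.Theorems.SuperadditiveResistance.DeviceLiouville.kin L 0 x - T) ∂((Literature.MathematicalPhysics.KineticTheory.HeatConduction.pinnedChain ω₂ lam β γ).gibbsMeasure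 L T))) ∧ Filter.Tendsto (fun δ => ∫ x, g δ x * (Summit.AtomisticToContinuum.FouriersLaw.Theorems.SuperadditiveResistance.DeviceLiouville.kin L (L - 1) x - T) ∂((Literature.MathematicalPhysics.KineticTheory.HeatConduction.pinnedChain ω₂ lam β γ).gibbsMeasure L T)) (nhdsWithin 0 {(0 : ℝ)}ᶜ) (nhds (∫ x, g 0 x * (Summit.AtomisticToContinuum.FouriersLaw.Theorems.SuperadditiveResistance.DeviceLiouville.kin L (L - 1) x - T) ∂((Literature.MathematicalPhysics.KineticTheory.HeatConduction.pinnedChain ω₂ lam β γ).gibbsMeasure L T))) := by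
  intro ω₂ lam β γ T ε hω hl hβ hγ hT hε μ hμ L hL
  have hL0 : 0 < L := by omega
  have hL1 : 1 < L := by omega
  -- notation-free abbreviations
  have hkin : ∀ y : PhaseSpace L, kin L 0 y = y.2 ⟨0, hL0⟩ ^ 2 := fun y => kin_eq_sq hL0 y
  obtain ⟨c, hc⟩ : ∃ c : ℝ → ℝ, ∀ δ, c δ = ∫ y, (kin L 0 y - T) ∂(μ L (T + δ / 2) (T - δ / 2)) := ⟨_, fun _ => rfl⟩
  have h140 : (0 : ℝ) < 1 / (4 * T) := by positivity
  have h1423 : 1 / (4 * T) < 2 / (3 * T) := by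
    rw [div_lt_div_iff₀ (by positivity) (by positivity)]; nlinarith
  have hθT : 1 / (4 * T) < 1 / max T T := by
    rw [max_self, one_div_lt_one_div (by positivity) hT]; linarith
  ------------------------------------------------------------------
  -- Step A: centred mild forward fields at `(T + δ/2, T − δ/2)`, `|δ| < T`
  ------------------------------------------------------------------
  have hA : ∀ δ : ℝ, |δ| < T → ∃ g : PhaseSpace L → ℝ, Measurable g ∧
      (∃ C : ℝ, ∀ z, |g z| ≤ C * Real.exp (1 / (4 * T) * (pinnedChain ω₂ lam β γ).hamiltonian L z)) ∧
      ∀ (hTL : 0 < T + δ / 2) (hTR : 0 < T - δ / 2), ∀ z, g z =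
        ∫ y, (((L : ℝ) * ε)⁻¹ * ((y.2 ⟨0, by omega⟩ ^ 2 - T) - c δ) +
            (L : ℝ)⁻¹ * ∑ i : Fin L, g (momentumFlip i y))
          ∂((pinnedChainSemigroup hω hl.le hβ.le hγ.le (by omega) hTL.le hTR.le).resolventKernel
            ((L : ℝ) * ε) z) := by
    intro δ hδ
    have hδ1 := abs_lt.1 hδ
    have hTL : 0 < T + δ / 2 := by linarith
    have hTR : 0 < T - δ / 2 := by linarith
    have hθ' : 1 / (4 * T) < 1 / max (T + δ / 2) (T - δ / 2) := h1423.trans (two_div_lt_inv_max hT hδ)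
    obtain ⟨g, hgm, hgb, hgeq⟩ :=
      flip_mildForwardField_exists_temps hω hl hβ hγ hL1 hT hTL hTR hθ' hε (hμ L _ _ hTL hTR)
    have hcδ : ∫ w, (w.2 ⟨0, Nat.zero_lt_of_lt hL1⟩ ^ 2 - T) ∂(μ L (T + δ / 2) (T - δ / 2)) = c δ := by
      rw [hc δ]
      exact integral_congr_ae (ae_of_all _ fun w => by simp only [hkin w])
    refine ⟨g, hgm, hgb, fun hTL' hTR' z => ?_⟩
    rw [hgeq z, hcδ]
  choose g hgm hgb hgeq using hA
  -- the `δ ≠ 0` family as a plain function of `δ`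
  obtain ⟨gf, hgf⟩ : ∃ gf : ℝ → PhaseSpace L → ℝ, ∀ (δ : ℝ) (h : |δ| < T), gf δ = g δ h :=
    ⟨fun δ => if h : |δ| < T then g δ h else 0, fun δ h => dif_pos h⟩
  ------------------------------------------------------------------
  -- Step B: the equilibrium field and its smooth classical representative
  ------------------------------------------------------------------
  obtain ⟨g₀, hg₀m, hg₀b, hg₀eq⟩ :=
    flip_mildForwardField_exists_temps hω hl hβ hγ hL1 hT hT hT hθT hε (hμ L T T hT hT)
  have hcT : ∫ w, (w.2 ⟨0, Nat.zero_lt_of_lt hL1⟩ ^ 2 - T) ∂(μ L T T) = 0 := by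
    rw [← integral_kin_sub_family_self hω hl.le hβ.le ε hμ hT hL0]
    exact integral_congr_ae (ae_of_all _ fun w => by simp only [hkin w])
  rw [hcT] at hg₀eq
  -- MILD at `(T, T)`: `g₀` is a distributional solution with source `−(k_0 − T) + 0`
  have hg₀weak := hMILD ω₂ lam β γ hω hl hβ hγ L hL T T T hT hT hT hθT ε hε 0 g₀ hg₀m hg₀b hg₀eq
  -- HYPO: a smooth representative
  have hF : ContDiff ℝ ((⊤ : ℕ∞) : WithTop ℕ∞) fun x : PhaseSpace L => -(kin L 0 x - T) + (0 : ℝ) := by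
    simp only [hkin]
    fun_prop
  obtain ⟨v, hvs, hae⟩ := hHYPO ω₂ lam β γ hω hl hβ hγ L hL T T ε hT hT hε.le g₀
    (fun x => -(kin L 0 x - T) + 0) hg₀m (hg₀b.imp fun C hC => ⟨1 / (4 * T), hC⟩) hF hg₀weak
  -- UPGRADE: `v` is bounded and mild
  obtain ⟨hvb, hveq⟩ := hUP ω₂ lam β γ hω hl hβ hγ L hL T hT ε hε 0 g₀ v hg₀m hg₀b hg₀eq hvs.continuous hae
  -- MILD for `v`, then classical
  have hvweak := hMILD ω₂ lam β γ hω hl hβ hγ L hL T T T hT hT hT hθT ε hε 0 v hvs.continuous.measurable hvb hveq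
  have hγT : 0 ≤ (pinnedChain ω₂ lam β γ).γ * T := by
    show 0 ≤ γ * T
    positivity
  have hclass := flip_classical_of_weak_smooth (pinnedChain ω₂ lam β γ) (pinnedChain_contDiff_U ω₂ lam β γ)
    (pinnedChain_contDiff_V ω₂ lam β γ) hL0 hγT hγT ε (u := v) (F := fun x => -(kin L 0 x - T) + 0) hvs
    hF.continuous hvweak
  -- the full family
  obtain ⟨gF, hgF0, hgFne⟩ : ∃ gF : ℝ → PhaseSpace L → ℝ, gF 0 = v ∧ ∀ δ, δ ≠ 0 → gF δ = gf δ :=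
    ⟨fun δ => if δ = 0 then v else gf δ, if_pos rfl, fun δ hδ => if_neg hδ⟩
  ------------------------------------------------------------------
  -- Step C: CONT for the `δ ≠ 0` family and the equilibrium field `v`
  ------------------------------------------------------------------
  have hct : Tendsto c (𝓝[≠] 0) (𝓝 0) := by
    have h := centring_tendsto_zero hω hl hβ hγ hε hμ hT hL
    refine h.congr' (Eventually.of_forall fun δ => (hc δ).symm)
  have hfam : ∀ (δ : ℝ) (hTL : 0 < T + δ / 2) (hTR : 0 < T - δ / 2), 0 < |δ| → |δ| < T →
      Measurable (gf δ) ∧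
      (∃ C : ℝ, ∀ z, |gf δ z| ≤ C * Real.exp (1 / (4 * T) * (pinnedChain ω₂ lam β γ).hamiltonian L z)) ∧
      ∀ z, gf δ z = ∫ y, (((L : ℝ) * ε)⁻¹ * ((y.2 ⟨0, by omega⟩ ^ 2 - T) - c δ) +
          (L : ℝ)⁻¹ * ∑ i : Fin L, gf δ (momentumFlip i y))
        ∂((pinnedChainSemigroup hω hl.le hβ.le hγ.le (by omega) hTL.le hTR.le).resolventKernel
          ((L : ℝ) * ε) z) := by
    intro δ hTL hTR _ hδ
    rw [hgf δ hδ]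
    exact ⟨hgm δ hδ, hgb δ hδ, hgeq δ hδ hTL hTR⟩
  obtain ⟨hlim0, hlim1⟩ := hCONT ω₂ lam β γ hω hl hβ hγ L hL T hT ε hε gf c v 0 T hT le_rfl hct hvs.continuous
    hvb hveq hfam
  ------------------------------------------------------------------
  -- Step D: the clauses of `FF''(ε)`
  ------------------------------------------------------------------
  refine ⟨gF, T, hT, ?_, ?_, ?_, ?_, ?_, ?_⟩
  · -- (i) `g 0 ∈ C²`
    rw [hgF0]
    exact hvs.of_le (by norm_cast)
  · -- (ii) the classical equilibrium equation
    intro x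
    rw [hgF0, OscillatorChain.flipGenerator_eq_add_flipNoise, hclass x, add_zero]
  · -- (iii) the `e^{H/4T}` bounds for `|δ| < T`
    intro δ hδ
    by_cases h0 : δ = 0
    · subst h0
      rw [hgF0]
      exact hvb
    · rw [hgFne δ h0, hgf δ hδ]
      exact hgb δ hδ
  · -- (iv) measurability and the distributional equation for `0 < |δ| < T` (MILD at `T ± δ/2`)
    intro δ h0 hδ
    have hne : δ ≠ 0 := abs_pos.1 h0
    have hδ1 := abs_lt.1 hδ
    have hTL : 0 < T + δ / 2 := by linarith
    have hTR : 0 < T - δ / 2 := by linarith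
    have hθ' : 1 / (4 * T) < 1 / max (T + δ / 2) (T - δ / 2) := h1423.trans (two_div_lt_inv_max hT hδ)
    rw [hgFne δ hne, hgf δ hδ]
    refine ⟨hgm δ hδ, ?_⟩
    have h := hMILD ω₂ lam β γ hω hl hβ hγ L hL T (T + δ / 2) (T - δ / 2) hT hTL hTR hθ' ε hε (c δ) (g δ hδ)
      (hgm δ hδ) (hgb δ hδ) (hgeq δ hδ hTL hTR)
    rw [hc δ] at h
    exact h
  · -- (v) continuity of the left Gibbs pairing
    rw [hgF0]
    refine hlim0.congr' ?_
    filter_upwards [self_mem_nhdsWithin] with δ hδ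
    rw [hgFne δ hδ]
  · -- (vi) continuity of the right Gibbs pairing
    rw [hgF0]
    refine hlim1.congr' ?_
    filter_upwards [self_mem_nhdsWithin] with δ hδ
    rw [hgFne δ hδ]

end Summit.AtomisticToContinuum.FouriersLaw.Theorems.NoisyFourier.FlipPositiveConductance

end
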